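import Summits.KontsevichZagierPeriods.KontsevichZagierPeriods.Theorems.HurwitzMicroSectorsNormalFormPrincipleM2FiveZetaTwo

/-!
# `NormalFormPrinciple` (stmt-KontsevichZagierPeriods-3869), line `SketchIdeator1` — leaf `stub_boxRigidity`:
# affine-unfoldable boxes: the affine-unfolding kit (polynomial edges and cyclotomic factorisations)

Registered sub-goal `affineUnfold_kit` of the wave "affine-unfoldable boxes `[(0,1)², 1/(A(x) + xy)]`"
(lead file `…M2AffineUnfold`). Two blocks.

1. For a polynomial edge `A = p ∈ ℚ[x]` with `p > 0` on `[0,1]`: the band-box representation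
   `[{0 < x < 1, 0 ≤ y ≤ 1}, 1/(p(x) + xy)]` exists (the integrand is a quotient of `ℚ`-polynomials
   with denominator `> 0` on the closed cube `[0,1]²`, hence `ℚ`-semialgebraic on the band-box and
   continuous on the compact cube, so absolutely integrable); `x ↦ p(x)` is `ℚ`-semialgebraic and
   differentiable on `(0,1) ⊆ ℝ¹`; the unfolded edge `(p(x) + x)/p(x)` is `ℚ`-semialgebraic on
   `(0,1)` and `≥ 1` there. The only algebraic input is
   `MvPolynomial.aeval z (Polynomial.aeval (X i) p) = Polynomial.aeval (z i) p`.
2. The four cyclotomic factorisations of `(A + x)/A` on `(0,1)` for `A = 1 + x²`, `1`, `1 + x + x²`,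
   `1 − x + x²` in terms of `G_{d+1} = ∑_{i ≤ d} xⁱ` and `H_{d+1} = 1/(1 − x^{d+1})` (pure algebra:
   `(1+x²)(1−x²) = 1−x⁴`, `1−x+x² = (1−x⁶)(1−x)/((1−x³)(1−x²))`).

References: M. Kontsevich, D. Zagier, *Periods* (2001), §1.2. No new definitions.
-/

noncomputable section

open MeasureTheory Set
open Literature.NumberTheory.Transcendental Literature.NumberTheory.Transcendental.KZ
open Literature.ModelTheory.ExponentialFields (IsSemialgebraic)

namespace Summit.KontsevichZagierPeriods.HurwitzMicroSectors.NormalFormPrinciple.PiBox.M2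

/-! ## Block 1: polynomial edges -/

/-- Evaluating the two-step substitution `p(X_i)` at a point `z` gives `p(z_i)`. [folklore] -/
theorem mvPolynomial_aeval_polynomial_aeval_X {m : ℕ} (p : Polynomial ℚ) (i : Fin m)
    (z : Fin m → ℝ) :
    MvPolynomial.aeval z (Polynomial.aeval (MvPolynomial.X i : MvPolynomial (Fin m) ℚ) p) =
      (Polynomial.aeval (z i) p : ℝ) := by
  rw [← Polynomial.aeval_algHom_apply, MvPolynomial.aeval_X]

/-- A rational polynomial `p`, as the function `y ↦ p(y 0)` on `ℝ¹`, is `ℚ`-semialgebraic on `(0,1)`.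
[cite: BochnakCosteRoy1998, §2.2] -/
theorem isSemialgebraicFunOn_polynomial_aeval (p : Polynomial ℚ) :
    IsSemialgebraicFunOn ℚ {y : Fin 1 → ℝ | 0 < y 0 ∧ y 0 < 1}
      (fun y => (fun x : ℝ => (Polynomial.aeval x p : ℝ)) (y 0)) :=
  (isSemialgebraicFunOn_aeval isSemialgebraic_unitInterval_fin_one
    (Polynomial.aeval (MvPolynomial.X 0 : MvPolynomial (Fin 1) ℚ) p)).congr fun y _ =>
    mvPolynomial_aeval_polynomial_aeval_X p 0 y

/-- A rational polynomial `p`, as the function `y ↦ p(y 0)` on `ℝ¹`, is differentiable on `(0,1)`.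
[folklore] -/
theorem differentiableOn_polynomial_aeval (p : Polynomial ℚ) :
    DifferentiableOn ℝ (fun y : Fin 1 → ℝ => (fun x : ℝ => (Polynomial.aeval x p : ℝ)) (y 0))
      {y : Fin 1 → ℝ | 0 < y 0 ∧ y 0 < 1} := by
  have h : Differentiable ℝ
      ((fun x : ℝ => (Polynomial.aeval x p : ℝ)) ∘ fun y : Fin 1 → ℝ => y 0) :=
    (Polynomial.differentiable_aeval p).comp (differentiable_apply 0)
  exact h.differentiableOn

/-- For `p > 0` on `[0,1]`, the unfolded edge `(p(x) + x)/p(x)` is `ℚ`-semialgebraic on `(0,1) ⊆ ℝ¹`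
(a quotient of `ℚ`-polynomials with non-vanishing denominator). [cite: BochnakCosteRoy1998, §2.2] -/
theorem isSemialgebraicFunOn_aeval_add_div_aeval (p : Polynomial ℚ)
    (hp : ∀ x ∈ Set.Icc (0:ℝ) 1, 0 < (Polynomial.aeval x p : ℝ)) :
    IsSemialgebraicFunOn ℚ {y : Fin 1 → ℝ | 0 < y 0 ∧ y 0 < 1}
      (fun y => (fun x : ℝ => ((Polynomial.aeval x p : ℝ) + x) / (Polynomial.aeval x p : ℝ))
        (y 0)) := by
  refine (isSemialgebraicFunOn_aeval_div_aeval isSemialgebraic_unitInterval_fin_one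
    (Polynomial.aeval (MvPolynomial.X 0 : MvPolynomial (Fin 1) ℚ) p + MvPolynomial.X 0)
    (Polynomial.aeval (MvPolynomial.X 0 : MvPolynomial (Fin 1) ℚ) p) fun y hy => ?_).congr
    fun y _ => ?_
  · rw [mvPolynomial_aeval_polynomial_aeval_X]
    exact (hp (y 0) ⟨hy.1.le, hy.2.le⟩).ne'
  · simp only [map_add, MvPolynomial.aeval_X, mvPolynomial_aeval_polynomial_aeval_X]

/-- For `p > 0` on `[0,1]`, the unfolded edge satisfies `(p(x) + x)/p(x) ≥ 1` on `(0,1)`. [folklore] -/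
theorem one_le_aeval_add_div_aeval (p : Polynomial ℚ)
    (hp : ∀ x ∈ Set.Icc (0:ℝ) 1, 0 < (Polynomial.aeval x p : ℝ)) :
    ∀ x ∈ Set.Ioo (0:ℝ) 1,
      1 ≤ (fun x : ℝ => ((Polynomial.aeval x p : ℝ) + x) / (Polynomial.aeval x p : ℝ)) x := by
  intro x hx
  have hp0 : 0 < (Polynomial.aeval x p : ℝ) := hp x ⟨hx.1.le, hx.2.le⟩
  show 1 ≤ ((Polynomial.aeval x p : ℝ) + x) / (Polynomial.aeval x p : ℝ)
  rw [le_div_iff₀ hp0]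
  linarith [hx.1]

/-- **The representation `[band-box, 1/(p(x) + xy)]` exists** for `p ∈ ℚ[x]` positive on `[0,1]`:
its integrand is a quotient of `ℚ`-polynomials whose denominator is `> 0` on the closed cube
`[0,1]² ⊇ band-box`, so it is `ℚ`-semialgebraic on the band-box and continuous on the compact cube,
hence absolutely integrable. [cite: KontsevichZagier2001, §1.1] -/
theorem exists_bandBoxRep_aeval_add_mul (p : Polynomial ℚ)
    (hp : ∀ x ∈ Set.Icc (0:ℝ) 1, 0 < (Polynomial.aeval x p : ℝ)) :
    ∃ T : IntegralRep 2,
      T.domain = KZlog.band {y : Fin 1 → ℝ | 0 < y 0 ∧ y 0 < 1} (fun _ => (0:ℝ)) (fun _ => (1:ℝ)) ∧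
      T.integrand = fun z => 1 / ((Polynomial.aeval (z 0) p : ℝ) + z 0 * z 1) := by
  have hB := isSemialgebraic_bandBox
  -- the denominator is positive on the closed cube
  have hpos : ∀ z ∈ Set.Icc (0 : Fin 2 → ℝ) 1, 0 < (Polynomial.aeval (z 0) p : ℝ) + z 0 * z 1 := by
    intro z hz
    have h0 : 0 ≤ z 0 := hz.1 0
    have h1 : 0 ≤ z 1 := hz.1 1
    have hp0 : 0 < (Polynomial.aeval (z 0) p : ℝ) := hp (z 0) ⟨h0, hz.2 0⟩
    positivity
  have hsa : IsSemialgebraicFunOn ℚ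
      (KZlog.band {y : Fin 1 → ℝ | 0 < y 0 ∧ y 0 < 1} (fun _ => (0:ℝ)) (fun _ => (1:ℝ)))
      (fun z => 1 / ((Polynomial.aeval (z 0) p : ℝ) + z 0 * z 1)) := by
    refine (isSemialgebraicFunOn_aeval_div_aeval hB 1
      (Polynomial.aeval (MvPolynomial.X 0 : MvPolynomial (Fin 2) ℚ) p +
        MvPolynomial.X 0 * MvPolynomial.X 1) fun x hx => ?_).congr fun x _ => ?_
    · rw [map_add, map_mul, MvPolynomial.aeval_X, MvPolynomial.aeval_X,
        mvPolynomial_aeval_polynomial_aeval_X]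
      exact (hpos x (bandBox_subset_Icc hx)).ne'
    · simp only [map_one, map_add, map_mul, MvPolynomial.aeval_X,
        mvPolynomial_aeval_polynomial_aeval_X]
  have hcont : ContinuousOn (fun z : Fin 2 → ℝ => 1 / ((Polynomial.aeval (z 0) p : ℝ) + z 0 * z 1))
      (Set.Icc (0 : Fin 2 → ℝ) 1) :=
    continuousOn_const.div (by fun_prop) fun z hz => (hpos z hz).ne'
  have hint : IntegrableOn (fun z : Fin 2 → ℝ => 1 / ((Polynomial.aeval (z 0) p : ℝ) + z 0 * z 1))
      (KZlog.band {y : Fin 1 → ℝ | 0 < y 0 ∧ y 0 < 1} (fun _ => (0:ℝ)) (fun _ => (1:ℝ))) :=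
    (hcont.integrableOn_compact isCompact_Icc).mono_set bandBox_subset_Icc
  exact ⟨⟨_, _, hB, hsa, hint⟩, rfl, rfl⟩

/-! ## Block 2: the four cyclotomic factorisations -/

/-- `A = 1 + x²`: `(A + x)/A = G₃ · H₄ / H₂` on `(0,1)`, since `(1 + x²)(1 − x²) = 1 − x⁴`.
[folklore] -/
theorem affineUnfold_factor_one_add_sq (x : ℝ) (hx : x ∈ Set.Ioo (0:ℝ) 1) :
    ((1 + x ^ 2) + x) / (1 + x ^ 2) =
      ((∑ i ∈ Finset.range (2 + 1), x ^ i) * (1 / (1 - x ^ (3 + 1)))) / (1 / (1 - x ^ (1 + 1))) := by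
  have h2 : (1:ℝ) - x ^ (1 + 1) ≠ 0 := (sub_pos.2 (pow_lt_one₀ hx.1.le hx.2 (by omega))).ne'
  have h4 : (1:ℝ) - x ^ (3 + 1) ≠ 0 := (sub_pos.2 (pow_lt_one₀ hx.1.le hx.2 (by omega))).ne'
  have hA : (1:ℝ) + x ^ 2 ≠ 0 := by positivity
  simp only [Finset.sum_range_succ, Finset.sum_range_zero, zero_add, pow_zero, pow_one]
  rw [div_eq_div_iff hA (div_ne_zero one_ne_zero h2)]
  field_simp
  ring

/-- `A = 1`: `(A + x)/A = G₂` on `(0,1)`. [folklore] -/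
theorem affineUnfold_factor_one (x : ℝ) :
    ((1 : ℝ) + x) / 1 = ∑ i ∈ Finset.range (1 + 1), x ^ i := by
  simp [Finset.sum_range_succ]

/-- `A = 1 + x + x²`: `(A + x)/A = G₂² / G₃` on `(0,1)`. [folklore] -/
theorem affineUnfold_factor_one_add_add_sq (x : ℝ) :
    ((1 + x + x ^ 2) + x) / (1 + x + x ^ 2) =
      (∑ i ∈ Finset.range (1 + 1), x ^ i) ^ 2 / ∑ i ∈ Finset.range (2 + 1), x ^ i := by
  simp only [Finset.sum_range_succ, Finset.sum_range_zero, zero_add, pow_zero, pow_one]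
  congr 1
  ring

/-- `A = 1 − x + x²`: `(A + x)/A = (H₁ · H₆)/(H₃ · H₄)` on `(0,1)`, since
`1 + x² = (1 − x⁴)/(1 − x²)` and `1 − x + x² = (1 − x⁶)(1 − x)/((1 − x³)(1 − x²))`. [folklore] -/
theorem affineUnfold_factor_one_sub_add_sq (x : ℝ) (hx : x ∈ Set.Ioo (0:ℝ) 1) :
    ((1 - x + x ^ 2) + x) / (1 - x + x ^ 2) =
      ((1 / (1 - x ^ (0 + 1))) * (1 / (1 - x ^ (5 + 1)))) /
        ((1 / (1 - x ^ (2 + 1))) * (1 / (1 - x ^ (3 + 1)))) := by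
  have h1 : (1:ℝ) - x ^ (0 + 1) ≠ 0 := (sub_pos.2 (pow_lt_one₀ hx.1.le hx.2 (by omega))).ne'
  have h6 : (1:ℝ) - x ^ (5 + 1) ≠ 0 := (sub_pos.2 (pow_lt_one₀ hx.1.le hx.2 (by omega))).ne'
  have h3 : (1:ℝ) - x ^ (2 + 1) ≠ 0 := (sub_pos.2 (pow_lt_one₀ hx.1.le hx.2 (by omega))).ne'
  have h4 : (1:ℝ) - x ^ (3 + 1) ≠ 0 := (sub_pos.2 (pow_lt_one₀ hx.1.le hx.2 (by omega))).ne'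
  have hA : (1:ℝ) - x + x ^ 2 ≠ 0 := by
    have : (0:ℝ) < 1 - x + x ^ 2 := by nlinarith [sq_nonneg (x - 1/2)]
    exact this.ne'
  rw [div_eq_div_iff hA (mul_ne_zero (div_ne_zero one_ne_zero h3) (div_ne_zero one_ne_zero h4))]
  field_simp
  ring

/-! ## The kit -/

/-- **Stub (affine-unfolding kit): polynomial edges `A = p(x)`, `p > 0` on `[0,1]` — existence of the
band-box `[band-box, 1/(p(x)+xy)]`, the data of `p` needed by the general unfolding, and the four
cyclotomic factorisations of `(A+x)/A`.** [cite: KontsevichZagier2001, §1.2] -/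
theorem affineUnfold_kit :
    (∀ (p : Polynomial ℚ), (∀ x ∈ Set.Icc (0:ℝ) 1, 0 < (Polynomial.aeval x p : ℝ)) →
      (∃ T : IntegralRep 2,
        T.domain = KZlog.band {y : Fin 1 → ℝ | 0 < y 0 ∧ y 0 < 1} (fun _ => (0:ℝ)) (fun _ => (1:ℝ)) ∧
        T.integrand = fun z => 1 / ((Polynomial.aeval (z 0) p : ℝ) + z 0 * z 1)) ∧
      IsSemialgebraicFunOn ℚ {y : Fin 1 → ℝ | 0 < y 0 ∧ y 0 < 1}
        (fun y => (fun x : ℝ => (Polynomial.aeval x p : ℝ)) (y 0)) ∧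
      DifferentiableOn ℝ (fun y : Fin 1 → ℝ => (fun x : ℝ => (Polynomial.aeval x p : ℝ)) (y 0))
        {y : Fin 1 → ℝ | 0 < y 0 ∧ y 0 < 1} ∧
      IsSemialgebraicFunOn ℚ {y : Fin 1 → ℝ | 0 < y 0 ∧ y 0 < 1}
        (fun y => (fun x : ℝ => ((Polynomial.aeval x p : ℝ) + x) / (Polynomial.aeval x p : ℝ)) (y 0)) ∧
      (∀ x ∈ Set.Ioo (0:ℝ) 1,
        1 ≤ (fun x : ℝ => ((Polynomial.aeval x p : ℝ) + x) / (Polynomial.aeval x p : ℝ)) x)) ∧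
    (∀ x ∈ Set.Ioo (0:ℝ) 1,
      ((1 + x ^ 2) + x) / (1 + x ^ 2) =
        ((∑ i ∈ Finset.range (2 + 1), x ^ i) * (1 / (1 - x ^ (3 + 1)))) / (1 / (1 - x ^ (1 + 1))) ∧
      ((1 : ℝ) + x) / 1 = ∑ i ∈ Finset.range (1 + 1), x ^ i ∧
      ((1 + x + x ^ 2) + x) / (1 + x + x ^ 2) =
        (∑ i ∈ Finset.range (1 + 1), x ^ i) ^ 2 / ∑ i ∈ Finset.range (2 + 1), x ^ i ∧
      ((1 - x + x ^ 2) + x) / (1 - x + x ^ 2) =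
        ((1 / (1 - x ^ (0 + 1))) * (1 / (1 - x ^ (5 + 1)))) /
          ((1 / (1 - x ^ (2 + 1))) * (1 / (1 - x ^ (3 + 1))))) := by
  refine ⟨fun p hp => ⟨exists_bandBoxRep_aeval_add_mul p hp, isSemialgebraicFunOn_polynomial_aeval p,
    differentiableOn_polynomial_aeval p, isSemialgebraicFunOn_aeval_add_div_aeval p hp,
    one_le_aeval_add_div_aeval p hp⟩, fun x hx => ⟨affineUnfold_factor_one_add_sq x hx,
    affineUnfold_factor_one x, affineUnfold_factor_one_add_add_sq x,
    affineUnfold_factor_one_sub_add_sq x hx⟩⟩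

end Summit.KontsevichZagierPeriods.HurwitzMicroSectors.NormalFormPrinciple.PiBox.M2
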